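import Literature.Computability.QuantumComplexity.PolyCopiesIdxLaw
import Literature.Computability.QuantumComplexity.PolyCopiesIdxUniform
import Literature.Computability.QuantumComplexity.PolyMajority
import Literature.Computability.Cryptography.ClassBQPComplementProofs
import HarnessLib

/-!
# Polynomially many parallel indexed copies, IV: the disjunctive read-out and the all-blocks bound

Topic `Literature/Computability/QuantumComplexity`; sequel of `PolyCopiesIdx.lean` /
`PolyCopiesIdxLaw.lean` (block `j < K(n)` of the indexed-copies family runs the given family `F`
on `x ++ e_j`; the measured block contents are independent with laws `F.kernel (x ++ e_j)`).
Two generic read-out facts for NON-ADAPTIVE (truth-table) uses of a quantum subroutine — "call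
the subroutine on the queries `q_0(x), …, q_{K-1}(x)` in parallel and combine the answers
classically" (Bennett–Bernstein–Brassard–Vazirani 1997, §4, proof of Thm. 4.14, the
non-adaptive case laid out in parallel; the classical combination being a *disjunctive*
truth-table, as in the Goldreich–Micciancio–Safra–Seifert reduction `GapSVP_γ ≤ GapCVP′_γ`,
Micciancio–Regev 2007, Lemma 5.22: "answer YES iff some call does"):

* `PolyCopiesIdx.anyF` — **the disjunctive read-out** as a string function on `⟨x, y⟩` (`y` the
  measured string of the indexed-copies family on `x`): the bit
  `[∃ j < K(|x|), y[blk |x| j 0] = 1]`, i.e. "some copy answered YES" (answer wire `0` of block `j`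
  sits at position `blk |x| j 0`). It is the counted loop of `PolyCopies.majF`
  (`PolyMajority.lean`) transported to the indexed layout, with the final comparison
  `[0 < #accepting copies]`; `anyF_mem_FP`, `anyF_boolPair`, `anyF_boolPair_eq_true_iff`;
* `PolyCopiesIdx.headD_segment` — the answer bit of copy `j` is the head of its segment;
* **`PolyCopiesIdx.kernelProb_segments_ge`** — if every copy `j < K(|x|)`, run on `x ++ e_j`,
  produces an output in `A j` with probability `≥ 1 − δ`, then ALL segments lie in their `A j`
  simultaneously with probability `≥ 1 − K(|x|) δ` (product law `kernel_toOuterMeasure_segments_pi`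
  and Bernoulli's inequality `(1 − δ)^K ≥ 1 − K δ`) — the union bound that drives every
  truth-table use of an error-reduced subroutine.

No named fact is introduced.

## References

* C. H. Bennett, E. Bernstein, G. Brassard, U. Vazirani, *Strengths and weaknesses of quantum
  computing*, SIAM J. Comput. 26 (1997) 1510–1523, Thm. 4.13 and proof of Thm. 4.14
  [BennettBernsteinBrassardVazirani1997].
* D. Micciancio, O. Regev, *Worst-case to average-case reductions based on Gaussian measures*,
  SIAM J. Comput. 37 (2007), Lemma 5.22 [MicciancioRegev2007].
* M. A. Nielsen, I. L. Chuang, *Quantum Computation and Quantum Information*, CUP 2010, §2.2.8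
  (measurement statistics of product states) [NielsenChuang2010].
* S. Arora, B. Barak, *Computational Complexity: A Modern Approach*, CUP 2009, §1.3 (bounded loops in
  polynomial time) [AroraBarak2009].
-/

noncomputable section

namespace Literature.Computability.QuantumComplexity

namespace PolyCopiesIdx

open _root_.Computability Polynomial Complexity Complexity.Brick Plumb HashBricks Cryptography Finset

variable (P : PolyCopies.Params)

/-! ### The disjunctive read-out as a string function -/

/-- The body of the read-out loop on records `⟨x, ⟨cnt, ⟨acc, rest⟩⟩⟩`: prepend the first bit of
`rest` (if any) to `acc` and drop one block width `b |x|` of `rest` (the body of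
`PolyCopies.majBody` for the indexed layout). [folklore] -/
def anyBody : List Bool → List Bool :=
  fanoutFn (appF ∘ fanoutFn (takeFn ∘ fanoutFn (fun _ => [true]) (sndPow 2)) (nthF 2))
    (dropFn ∘ fanoutFn (polyFn (bPoly P) ∘ nthF 0) (sndPow 2))

/-- The initial record `⟨x, ⟨bin K(|x|), ⟨[], y after the first base |x| bits⟩⟩⟩` from `⟨x, y⟩`.
[folklore] -/
def anyInit : List Bool → List Bool :=
  fanoutFn fstF (fanoutFn (lenBinF ∘ polyFn (KPoly P) ∘ fstF)
    (fanoutFn (fun _ => []) (dropFn ∘ fanoutFn (polyFn (basePoly P) ∘ fstF) sndF)))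

/-- The read-out loop: `K(|x|)` rounds of `anyBody`. [cite: AroraBarak2009, §1.3 (bounded loops)] -/
def anyLoop : List Bool → List Bool := fun z => (loopStep (anyBody P))^[(KPoly P).eval (fstF z).length] z

/-- The final test `[0 < number of ones collected]`. [folklore] -/
def anyPost : List Bool → List Bool :=
  ltFn ∘ fanoutFn (fun _ => []) (popCountFn ∘ nthF 2)

/-- **The disjunctive read-out** of the indexed `K(n)`-copy family: on `⟨x, y⟩`, the bit
`[0 < #{j < K(|x|) | y[blk |x| j 0] = 1}]` ("answer YES iff some call does").
[cite: MicciancioRegev2007, Lemma 5.22 (disjunctive combination of the oracle answers)] -/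
def anyF : List Bool → List Bool := anyPost ∘ anyLoop P ∘ anyInit P

variable {P}

/-- Growth of the loop body: the state grows by at most `4` symbols per round. [folklore] -/
theorem length_anyBody_le (z : List Bool) : (anyBody P z).length ≤ (sndPow 1 z).length + 4 * ((fstF z).length + 1) := by
  have h1 : 2 * (nthF 2 z).length + (sndPow 2 z).length ≤ (sndPow 1 z).length := length_nthF_succ_add_sndPow_succ_le 1 z
  have htake : (takeFn (boolPair [true] (sndPow 2 z))).length ≤ 1 := by
    rw [takeFn_boolPair]; exact (List.length_take_le _ _).trans (by simp)
  have hdrop : (dropFn (boolPair (polyFn (bPoly P) (nthF 0 z)) (sndPow 2 z))).length ≤ (sndPow 2 z).length := by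
    rw [dropFn_boolPair, List.length_drop]; exact Nat.sub_le _ _
  simp only [anyBody, fanoutFn_apply, Function.comp_apply, length_boolPair, appF, fstF_boolPair, sndF_boolPair,
    List.length_append]
  omega

/-- `anyBody ∈ FP`. [folklore] -/
theorem anyBody_mem_FP : anyBody P ∈ FP :=
  fanoutFn_mem_FP (comp_mem_FP appF_mem_FP (fanoutFn_mem_FP (comp_mem_FP takeFn_mem_FP (fanoutFn_mem_FP (const_mem_FP _) (sndPow_mem_FP 2)))
    (nthF_mem_FP 2))) (comp_mem_FP dropFn_mem_FP (fanoutFn_mem_FP (comp_mem_FP (polyFn_mem_FP _) (nthF_mem_FP 0)) (sndPow_mem_FP 2)))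

/-- `anyInit ∈ FP`. [folklore] -/
theorem anyInit_mem_FP : anyInit P ∈ FP :=
  fanoutFn_mem_FP fstF_mem_FP (fanoutFn_mem_FP (comp_mem_FP lenBinF_mem_FP (comp_mem_FP (polyFn_mem_FP _) fstF_mem_FP))
    (fanoutFn_mem_FP (const_mem_FP _) (comp_mem_FP dropFn_mem_FP (fanoutFn_mem_FP (comp_mem_FP (polyFn_mem_FP _) fstF_mem_FP) sndF_mem_FP))))

/-- `anyLoop ∈ FP`. [cite: AroraBarak2009, §1.3 (bounded loops)] -/
theorem anyLoop_mem_FP : anyLoop P ∈ FP := loopFn_mem_FP anyBody_mem_FP length_anyBody_le (KPoly P)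

/-- `anyPost ∈ FP`. [folklore] -/
theorem anyPost_mem_FP : anyPost ∈ FP :=
  comp_mem_FP ltFn_mem_FP (fanoutFn_mem_FP (const_mem_FP _) (comp_mem_FP popCountFn_mem_FP (nthF_mem_FP 2)))

/-- **The disjunctive read-out is polynomial time.** [cite: AroraBarak2009, §1.3 (bounded loops in polynomial time)] -/
theorem anyF_mem_FP : anyF P ∈ FP := comp_mem_FP anyPost_mem_FP (comp_mem_FP anyLoop_mem_FP anyInit_mem_FP)

/-! ### Semantics of the read-out -/

/-- The data after `i` rounds: `y` with `base n + i · b n` bits dropped. [folklore] -/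
def restAt (n : ℕ) (y : List Bool) (i : ℕ) : List Bool := y.drop (base P n + i * b P n)

/-- The collected bits after `i` rounds (latest first). [folklore] -/
def accAt (n : ℕ) (y : List Bool) : ℕ → List Bool
  | 0 => []
  | i + 1 => (restAt (P := P) n y i).take 1 ++ accAt n y i

/-- One round of the body on a well-formed record. [folklore] -/
theorem anyBody_record (x c : List Bool) (y : List Bool) (i : ℕ) :
    anyBody P (boolPair x (boolPair c (boolPair (accAt (P := P) x.length y i) (restAt (P := P) x.length y i)))) =
      boolPair (accAt (P := P) x.length y (i + 1)) (restAt (P := P) x.length y (i + 1)) := by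
  simp only [anyBody, fanoutFn_apply, Function.comp_apply, sndPow_succ_boolPair, sndPow_zero_boolPair, nthF_succ_boolPair,
    nthF_zero_boolPair, takeFn_boolPair, dropFn_boolPair, polyFn_apply, eval_bPoly, appF, fstF_boolPair, sndF_boolPair, accAt,
    restAt, List.drop_drop, ones, List.length_replicate, List.length_singleton]
  congr 2
  ring

/-- The loop model runs the rounds. [folklore] -/
theorem loopModel_anyBody (x : List Bool) (y : List Bool) : ∀ (k i : ℕ),
    loopModel (anyBody P) x k (boolPair (accAt (P := P) x.length y i) (restAt (P := P) x.length y i)) =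
      boolPair (accAt (P := P) x.length y (i + k)) (restAt (P := P) x.length y (i + k))
  | 0, i => rfl
  | k + 1, i => by
    rw [loopModel, anyBody_record, loopModel_anyBody x y k (i + 1)]
    congr 2 <;> ring

/-- Counting the collected ones: the number of positions `blk n j 0`, `j < i`, at which `y` reads `1`.
[folklore] -/
theorem count_accAt (n : ℕ) (y : List Bool) : ∀ i : ℕ,
    (accAt (P := P) n y i).count true = ((Finset.range i).filter fun j => y.getD (blk P n j 0) false = true).card
  | 0 => by simp [accAt]
  | i + 1 => by
    rw [accAt, List.count_append, count_accAt n y i, Finset.range_add_one, Finset.filter_insert]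
    have hpos : blk P n i 0 = base P n + i * b P n := by unfold blk; omega
    have htake : ((restAt (P := P) n y i).take 1).count true = if y.getD (blk P n i 0) false = true then 1 else 0 := by
      rw [restAt, hpos.symm, List.getD_eq_getElem?_getD]
      cases h : y.drop (blk P n i 0) with
      | nil =>
        have : y[blk P n i 0]? = none := by
          rw [List.getElem?_eq_none]; exact List.drop_eq_nil_iff.1 h
        simp [this]
      | cons a l =>
        have : y[blk P n i 0]? = some a := by
          have e := List.getElem?_drop (xs := y) (i := blk P n i 0) (j := 0)
          rw [h, Nat.add_zero] at e
          simpa using e.symm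
        rw [this]
        cases a <;> simp
    rw [htake]
    split_ifs with h
    · rw [Finset.card_insert_of_notMem (fun h' => Finset.notMem_range_self (Finset.mem_filter.1 h').1)]
      omega
    · omega

/-- The number of copies `j < K n` whose answer position reads `1`. [folklore] -/
def accCount (x y : List Bool) : ℕ := ((Finset.range (K P x.length)).filter fun j => y.getD (blk P x.length j 0) false = true).card

/-- **Semantics of the disjunctive read-out**: `anyF ⟨x, y⟩ = [0 < #{j < K(|x|) | y[blk |x| j 0] = 1}]`.
[cite: MicciancioRegev2007, Lemma 5.22 (answer YES iff some call does)] -/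
theorem anyF_boolPair (x y : List Bool) : anyF P (boolPair x y) = [decide (0 < accCount (P := P) x y)] := by
  have hinit : anyInit P (boolPair x y) =
      boolPair x (boolPair (encodeNat (K P x.length)) (boolPair (accAt (P := P) x.length y 0) (restAt (P := P) x.length y 0))) := by
    simp [anyInit, fanoutFn_apply, accAt, restAt, ones]
  have hloop : anyLoop P (anyInit P (boolPair x y)) =
      boolPair x (boolPair [] (boolPair (accAt (P := P) x.length y (K P x.length)) (restAt (P := P) x.length y (K P x.length)))) := by
    rw [anyLoop, hinit, fstF_boolPair, eval_KPoly, iterate_loopStep (anyBody P) x (K P x.length) (K P x.length) _ le_rfl,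
      loopModel_anyBody x y (K P x.length) 0, Nat.zero_add]
  rw [anyF, Function.comp_apply, Function.comp_apply, hloop]
  simp only [anyPost, Function.comp_apply, fanoutFn_apply, nthF_zero_boolPair, nthF_succ_boolPair,
    popCountFn_apply, ltFn_boolPair, bitsToNat_nil, bitsToNat_encodeNat, count_accAt, accCount]
  congr 1

/-- **The read-out is `1` iff some copy's answer position reads `1`.** [folklore] -/
theorem anyF_boolPair_eq_true_iff (x y : List Bool) :
    anyF P (boolPair x y) = [true] ↔ ∃ j < K P x.length, y.getD (blk P x.length j 0) false = true := by
  rw [anyF_boolPair]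
  simp only [List.cons.injEq, and_true, decide_eq_true_eq, accCount, Finset.card_pos, Finset.filter_nonempty_iff,
    Finset.mem_range]

/-- **The read-out is `0` iff no copy's answer position reads `1`.** [folklore] -/
theorem anyF_boolPair_eq_false_iff (x y : List Bool) :
    anyF P (boolPair x y) = [false] ↔ ∀ j < K P x.length, y.getD (blk P x.length j 0) false = false := by
  rw [anyF_boolPair]
  simp only [List.cons.injEq, and_true, decide_eq_false_iff_not, accCount, Finset.card_pos, Finset.filter_nonempty_iff,
    Finset.mem_range, not_exists, not_and, Bool.not_eq_true]

/-! ### Segments and answer positions -/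

/-- **The answer bit of copy `j` is the head of its segment**: `(segment n w j).headD false = w[blk n j 0]`
(default `false`). [folklore] -/
theorem headD_segment (n : ℕ) (w : List Bool) (j : ℕ) :
    (segment P n w j).headD false = w.getD (blk P n j 0) false := by
  have hpos : 0 < nIn P n + P.F.ancillas (nIn P n) := by
    have := K_pos (P := P) n; unfold nIn; omega
  rw [segment, List.getD_eq_getElem?_getD, List.headD_eq_head?_getD, List.head?_take, if_neg hpos.ne', List.head?_drop]

/-! ### The all-blocks bound -/

/-- The kernel probability of an event for the indexed-copies family, as the real part of the outer
measure of its kernel (definitional). [folklore] -/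
theorem kernelProb_eq_toReal (F : QCircuitFamily cliffordT) (x : List Bool) (E : Set (List Bool)) :
    F.kernelProb 0 x E = ((F.kernel 0 x).toOuterMeasure E).toReal := rfl

/-- **Bernoulli**: `1 − K δ ≤ (1 − δ)^K` for `δ ≤ 1`. [folklore] -/
theorem one_sub_mul_le_one_sub_pow {δ : ℝ} (h1 : δ ≤ 1) (K : ℕ) : 1 - K * δ ≤ (1 - δ) ^ K := by
  have h := one_add_mul_le_pow (show (-2 : ℝ) ≤ -δ by linarith) K
  have e : (1 : ℝ) + K * -δ = 1 - K * δ := by ring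
  have e' : (1 : ℝ) + -δ = 1 - δ := by ring
  rw [e, e'] at h
  exact h

/-- **The all-blocks bound (union bound for the indexed copies).** If for every block
`j < K(|x|)` the given family, run on `x ++ e_j`, outputs a string in `A j` with probability at least
`1 − δ` (`δ ≤ 1`), then the indexed-copies family on `x` outputs a string ALL of whose `K(|x|)`
segments lie in their `A j`, with probability at least `1 − K(|x|) δ`: the segments are independent
with the laws of the copies (`kernel_toOuterMeasure_segments_pi`, `blockLaw_eq_kernel`), so the
probability is `∏ⱼ Pr[A j] ≥ (1 − δ)^{K} ≥ 1 − K δ`.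
[cite: BennettBernsteinBrassardVazirani1997, Thm. 4.14 (proof: polynomially many subroutine calls, each with error ε, total deviation bounded by the sum)] -/
theorem kernelProb_segments_ge (x : List Bool) (A : Fin (K P x.length) → Set (List Bool)) {δ : ℝ}
    (h1 : δ ≤ 1) (h : ∀ j : Fin (K P x.length), 1 - δ ≤ P.F.kernelProb 0 (inputIdx P x j) (A j)) :
    1 - K P x.length * δ ≤
      (family P).kernelProb 0 x {w | ∀ j : Fin (K P x.length), segment P x.length w j ∈ A j} := by
  rw [kernelProb_eq_toReal, kernel_toOuterMeasure_segments_pi, ENNReal.toReal_prod]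
  have hfac : ∀ j : Fin (K P x.length), ((blockLaw P x j).toOuterMeasure (A j)).toReal = P.F.kernelProb 0 (inputIdx P x j) (A j) := by
    intro j
    rw [blockLaw_eq_kernel, kernelProb_eq_toReal]
  simp_rw [hfac]
  calc 1 - K P x.length * δ ≤ (1 - δ) ^ K P x.length := one_sub_mul_le_one_sub_pow h1 _
    _ = ∏ _j : Fin (K P x.length), (1 - δ) := by rw [Finset.prod_const, Finset.card_univ, Fintype.card_fin]
    _ ≤ ∏ j : Fin (K P x.length), P.F.kernelProb 0 (inputIdx P x j) (A j) :=
        Finset.prod_le_prod (fun j _ => by linarith) fun j _ => h j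

end PolyCopiesIdx

end Literature.Computability.QuantumComplexity

end
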